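import Mathlib
import HarnessLib
import Summits.HubbardSuperconductivity.HubbardSuperconductivity.Theorems.KLProgrammeKLRegimeEngineScaleZeroOverlapL1
import Summits.HubbardSuperconductivity.HubbardSuperconductivity.Theorems.KLProgrammeKLRegimeTorusL1MixedDifferencesMoment

/-!
# KL programme — K3 ENGINE child (`KLRegimeEngineV17F2`, stmt-HubbardSuperconductivity-20437): the WEIGHTED single-family torus bound from
# symbol data with MIXED ORDERS along the tangent — the W1 door (v2)

Cell `gate-hubbard-kl`, seat p3 (g10); W1 of the (E4)ₙ supply (aniso + weight twin of `IsoTorusBoundAt` at scale `n`), located risk «(b)-Wt@j≥1».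
The v1 door `torusSumWt_le_of_symbol_bounds` (`…EngineTorusSumMoment`, p3 g9) asks for THIRD differences of the padded multiplier along the sector
tangent `v` at the anisotropic rate `s₃` — not n-free on the flow frame (finding W1-TAN3, KL STATUS 2026-08-27 15:19Z: the isotropic (I-F jets)
`‖D³K_n‖ ≲ Gfr₃U²4ⁿ` overshoot the tangential third-derivative budget `8ⁿ` by `U²2ⁿ`).  This is the v2 door through the mixed master lemma
`sum_wt_norm_charSum_le_of_mixed_differences`: along `v` the padded symbol carries SECOND differences at the anisotropic rate `s₃` (the n-free `C²`
datum of p4's order-two layer) and THIRD differences at the isotropic rate `s₃'` (isotropic `C³` data, harmless at the normal scale):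

  **`torusSumWt_le_of_symbol_bounds_mixed`** — if `conj F_ω = F_ω`, `‖F_ω‖ ≤ 1`, the padded symbol has support `≤ N_s`, pointwise THIRD differences
  `≤ (4/(s₀·4M))³` (time), `≤ (4/(s₁L))³` (axes), `≤ (4/(s₂L))³` (`v⊥`), `≤ (4/(s₃'L))³` (`v`) and SECOND differences `≤ (4/(s₃L))²` (`v`), then for
  every sector `ω` and charge `c`
  `(|β|L²)⁻¹ Σ_{(d,w)} (1 + s₀|d̃| + s₁|w̃₁| + s₁|w̃₂|)·‖Σ_k F_ω(k) Χ_c(k; d, w)‖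
     ≤ (|β|L²)⁻¹ · √(524288(1/s₀+1)[C_w'²·(2√2/(s₂|v|)+2)(2√2/(s₃|v|)+2) + (1/s₁+1)²/(1+s₁R₀)]) · √(24·4M·L²·N_s)`,
  `C_w' = 1 + 2√2s₁/(s₂|v|) + 2√2s₁/(s₃'|v|)`, for every near radius `R₀` with `2(|v₁|+|v₂|)R₀ < L`.

On a scale-`n` sector: `|v| ≍ 2ⁿ`, `s₀ ≍ Λ_nβ/4M`, `s₁ ≍ s₂|v| ≍ s₃'|v| ≍ Λ_n`, `s₃ ≍ Λ_n` (per unit `⟨z,v⟩`): `C_w' = O(1)` and the right side is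
`O(M/β)` — the n-free `T_w` of W1.  Everything is proved; no definitions, no named facts, no sorry.  Nothing asserts superconductivity.
-/

noncomputable section

namespace Summit.HubbardSuperconductivity.HubbardSuperconductivity.Theorems.EngineV8

set_option linter.dupNamespace false -- summit = problem name (single-conjunct summit), D-0017

open Real Finset Literature.MathematicalPhysics.QuantumLattice Literature.Probability.LatticeModels
open Summit.HubbardSuperconductivity.HubbardSuperconductivity.Theorems.KLRegimeSplit
open Summit.HubbardSuperconductivity.HubbardSuperconductivity.Theorems.DispersionFlow
open Summit.HubbardSuperconductivity.HubbardSuperconductivity.Theorems.KLProgrammeLegKernels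
open Summit.HubbardSuperconductivity.HubbardSuperconductivity.Theorems.TorusFourierL2
open scoped ComplexConjugate

variable {L M : ℕ} [NeZero L] {Ns : ℕ}

/-- **The WEIGHTED single-family torus bound from symbol data, mixed orders along the tangent** (one position moment; third single-direction
differences in time, along the axes, along `v⊥` and along `v` at the rate `s₃'`; second differences along `v` at the rate `s₃`): for a real multiplier
family `F_ω` with `‖F_ω‖ ≤ 1`, padded-symbol support `≤ N_s`, every `ω`, `c`:
`(|β|L²)⁻¹ Σ_{(d,w)} (1 + s₀|d̃| + s₁|w̃₁| + s₁|w̃₂|)·‖Σ_k F_ω(k) Χ_c(k;(d,w))‖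
  ≤ (|β|L²)⁻¹·√(524288(1/s₀+1)[C_w'²·(2√2/(s₂|v|)+2)(2√2/(s₃|v|)+2) + (1/s₁+1)²/(1+s₁R₀)])·√(24·4M·L²·N_s)`.
[cite: BenfattoGiulianiMastropietro2006, Lemma 2.2 (2.52)–(2.55), §2.6 (2.81) and footnote 1] -/
theorem torusSumWt_le_of_symbol_bounds_mixed [NeZero M] (β : ℝ) (F : Fin Ns → FreqMomentum L M → ℂ)
    (hreal : ∀ ω k, conj (F ω k) = F ω k) (hF1 : ∀ ω k, ‖F ω k‖ ≤ 1)
    (v : Fin 2 → ℤ) (hv : v ≠ 0) {s₀ s₁ s₂ s₃ s₃' : ℝ} (hs₀ : 0 < s₀) (hs₁ : 0 < s₁) (hs₂ : 0 < s₂) (hs₃ : 0 < s₃) (hs₃' : 0 < s₃')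
    {R₀ : ℕ} (hR₀ : 2 * (|v 0| + |v 1|) * (R₀ : ℤ) < L) {Nsupp : ℕ}
    (hsupp : ∀ ω, (univ.filter fun q : TorusSite 1 (2 * (2 * M)) × TorusSite 2 L =>
      (if h : (q.1 0).val < 2 * M then F ω (⟨(q.1 0).val, h⟩, q.2) else 0) ≠ 0).card ≤ Nsupp)
    (h₀ : ∀ ω q, ‖(fwdDiff ((fun _ : Fin 1 => (1 : ZMod (2 * (2 * M)))), (0 : TorusSite 2 L)))^[3]
      (fun q : TorusSite 1 (2 * (2 * M)) × TorusSite 2 L =>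
        if h : (q.1 0).val < 2 * M then F ω (⟨(q.1 0).val, h⟩, q.2) else 0) q‖ ≤ (4 / (s₀ * (2 * (2 * M) : ℕ))) ^ 3)
    (h₁ : ∀ ω q (i : Fin 2), ‖(fwdDiff ((0 : TorusSite 1 (2 * (2 * M))), (Pi.single i (1 : ZMod L) : TorusSite 2 L)))^[3]
      (fun q : TorusSite 1 (2 * (2 * M)) × TorusSite 2 L =>
        if h : (q.1 0).val < 2 * M then F ω (⟨(q.1 0).val, h⟩, q.2) else 0) q‖ ≤ (4 / (s₁ * L)) ^ 3)
    (h₂ : ∀ ω q, ‖(fwdDiff ((0 : TorusSite 1 (2 * (2 * M))), (fun j => ((![-v 1, v 0] j : ℤ) : ZMod L))))^[3]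
      (fun q : TorusSite 1 (2 * (2 * M)) × TorusSite 2 L =>
        if h : (q.1 0).val < 2 * M then F ω (⟨(q.1 0).val, h⟩, q.2) else 0) q‖ ≤ (4 / (s₂ * L)) ^ 3)
    (h₃ : ∀ ω q, ‖(fwdDiff ((0 : TorusSite 1 (2 * (2 * M))), (fun j => ((v j : ℤ) : ZMod L))))^[2]
      (fun q : TorusSite 1 (2 * (2 * M)) × TorusSite 2 L =>
        if h : (q.1 0).val < 2 * M then F ω (⟨(q.1 0).val, h⟩, q.2) else 0) q‖ ≤ (4 / (s₃ * L)) ^ 2)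
    (h₃' : ∀ ω q, ‖(fwdDiff ((0 : TorusSite 1 (2 * (2 * M))), (fun j => ((v j : ℤ) : ZMod L))))^[3]
      (fun q : TorusSite 1 (2 * (2 * M)) × TorusSite 2 L =>
        if h : (q.1 0).val < 2 * M then F ω (⟨(q.1 0).val, h⟩, q.2) else 0) q‖ ≤ (4 / (s₃' * L)) ^ 3)
    (ω : Fin Ns) (c : Fin 2) :
    1 / (|β| * (L : ℝ) ^ 2) *
        ∑ dw : TorusSite 1 (2 * (2 * M)) × TorusSite 2 L,
          (1 + s₀ * |(((dw.1 0).valMinAbs : ℤ) : ℝ)| + s₁ * |(((dw.2 0).valMinAbs : ℤ) : ℝ)| + s₁ * |(((dw.2 1).valMinAbs : ℤ) : ℝ)|) *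
          ‖∑ k : FreqMomentum L M, F ω k *
            (if c = 0 then torusChar (fun _ : Fin 1 => ((k.1 : ℕ) : ZMod (2 * (2 * M)))) dw.1 * torusChar k.2 dw.2
              else conj (torusChar (fun _ : Fin 1 => ((k.1 : ℕ) : ZMod (2 * (2 * M)))) dw.1 * torusChar k.2 dw.2))‖ ≤
      1 / (|β| * (L : ℝ) ^ 2) *
        (Real.sqrt (524288 * (1 / s₀ + 1) *
            ((1 + 2 * Real.sqrt 2 * s₁ / (s₂ * Real.sqrt ((v 0 : ℝ) ^ 2 + (v 1 : ℝ) ^ 2)) +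
                2 * Real.sqrt 2 * s₁ / (s₃' * Real.sqrt ((v 0 : ℝ) ^ 2 + (v 1 : ℝ) ^ 2))) ^ 2 *
              ((2 * Real.sqrt 2 / (s₂ * Real.sqrt ((v 0 : ℝ) ^ 2 + (v 1 : ℝ) ^ 2)) + 2) *
                (2 * Real.sqrt 2 / (s₃ * Real.sqrt ((v 0 : ℝ) ^ 2 + (v 1 : ℝ) ^ 2)) + 2))
              + (1 / s₁ + 1) ^ 2 / (1 + s₁ * R₀))) *
          Real.sqrt (24 * (2 * (2 * M) : ℕ) * (L : ℝ) ^ 2 * Nsupp)) := by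
  classical
  haveI : NeZero (2 * (2 * M)) := ⟨by have := NeZero.ne M; omega⟩
  refine mul_le_mul_of_nonneg_left ?_ (by positivity)
  -- reduce the conjugate orientation to the direct one
  have hc : ∀ dw : TorusSite 1 (2 * (2 * M)) × TorusSite 2 L, ‖∑ k : FreqMomentum L M, F ω k *
      (if c = 0 then torusChar (fun _ : Fin 1 => ((k.1 : ℕ) : ZMod (2 * (2 * M)))) dw.1 * torusChar k.2 dw.2
        else conj (torusChar (fun _ : Fin 1 => ((k.1 : ℕ) : ZMod (2 * (2 * M)))) dw.1 * torusChar k.2 dw.2))‖ =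
      ‖∑ k : FreqMomentum L M, F ω k *
        (torusChar (fun _ : Fin 1 => ((k.1 : ℕ) : ZMod (2 * (2 * M)))) dw.1 * torusChar k.2 dw.2)‖ := by
    intro dw
    by_cases hc0 : c = 0
    · simp only [hc0, if_true]
    · simp only [hc0, if_false]
      exact norm_charSum_conj_eq F hreal ω dw.1 dw.2
  simp_rw [hc, charSum_freqMomentum_eq_charSum_padded F ω]
  -- the padded symbol
  set G : TorusSite 1 (2 * (2 * M)) × TorusSite 2 L → ℂ := fun q =>
    if h : (q.1 0).val < 2 * M then F ω (⟨(q.1 0).val, h⟩, q.2) else 0 with hG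
  have hsup : ∀ q, ‖G q‖ ≤ 1 := fun q => by
    rw [hG]
    dsimp only
    split_ifs
    · exact hF1 ω _
    · rw [norm_zero]; exact zero_le_one
  -- the master lemma at `A₀ = 1`
  have hmain := sum_wt_norm_charSum_le_of_mixed_differences G v hv hs₀ hs₁ hs₂ hs₃ hs₃' hR₀ zero_le_one (hsupp ω) hsup
    (fun q => by rw [one_mul]; exact h₀ ω q)
    (fun q i => by rw [one_mul]; exact h₁ ω q i)
    (fun q => by rw [one_mul]; exact h₂ ω q)
    (fun q => by rw [one_mul]; exact h₃ ω q)
    (fun q => by rw [one_mul]; exact h₃' ω q)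
  rw [mul_one] at hmain
  convert hmain using 2

end Summit.HubbardSuperconductivity.HubbardSuperconductivity.Theorems.EngineV8

end
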